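import Summits.RiemannHypothesis.RiemannHypothesis.Theorems.RuelleBandCofiniteCriticalLineStubBranchesContinuousAux2
import HarnessLib

/-!
# Stub `stub_branchesContinuous` of the line `cofinite-weil-index-staircase`
(crux `RuelleBand.CofiniteCriticalLine`, item stmt-RiemannHypothesis-2064)

**Every Courant–Fischer level of the window form is continuous in the window.**  With Weil's
quadratic functional `Q = weilQuadratic` and, for a window `a` and `k : ℕ`,
`level a k = inf over linearly independent (k+1)-tuples g of test functions supported in [-a, a]
of sup {Re Q(∑ cᵢ gᵢ) : ∫ ‖∑ cᵢ gᵢ‖² = 1}` (written out verbatim in the statement), the theorem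
`stub_branchesContinuous` says that `a ↦ level a k` is continuous on `(0, ∞)` for every `k`.

The case `k = 0` is Suzuki 2026, Thm. 1.3 (`Suzuki2026_thm_1_3_holds`,
`Literature/NumberTheory/LFunctions/WeilWindowSuzukiContinuityProofs.lean`).  The proof here is
the same dilation argument run on whole `(k+1)`-dimensional trial spaces: by the uniform modulus
`exists_weilDilate_modulus` (`|Re Q(f_η) − Re Q(f)| ≤ ε` for `|η| ≤ δ`, uniformly over
normalised window tests of bounded energy) and the facts that Bombieri's dilation
`f_η(t) = (1+η)^{1/2} f((1+η)t)` is linear, `L²`-isometric, injective and maps the window `a` to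
`a/(1+η)`, the dilate of a near-optimal trial space of the window `a₀` is a trial space of the
window `a` with `sup` raised by at most `ε` (upper bound near `a₀`), and the dilate of any trial
space of the window `a ≤ 2a₀` with `sup ≤ level a₀ k + 1` is a trial space of the window `a₀`
(lower bound near `a₀`).  The finite-span infrastructure (sesquilinear expansion, compactness of
the coefficient ellipsoid, disjoint bumps, `csInf`/`csSup` bookkeeping) is in the two auxiliary
files `…StubBranchesContinuousAux.lean`, `…StubBranchesContinuousAux2.lean`.
-/

set_option linter.dupNamespace false

noncomputable section

open Complex MeasureTheory Filter Set
open scoped BigOperators Topology ComplexConjugate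

namespace Summit.RiemannHypothesis.RiemannHypothesis.Theorems.RuelleBandCofiniteCriticalLine

open Literature.NumberTheory.LFunctions

/-- **Continuity of the `k`-th level at every window `a₀ > 0`.** Upper bound near `a₀`: dilate a
near-optimal trial space of the window `a₀` into the window `a` (`η = a₀/a − 1`). Lower bound
near `a₀`: dilate every trial space of the window `a ≤ 2a₀` with `sup ≤ level a₀ k + 1` into the
window `a₀` (`η = a/a₀ − 1`); trial spaces with larger `sup` need no argument. Both use the
uniform modulus `exists_weilDilate_modulus` (Suzuki 2026, proof of Thm. 1.3, minimiser-free form).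
[folklore] -/
theorem stub_branchesContinuous_continuousAt (k : ℕ) {a₀ : ℝ} (ha₀ : 0 < a₀) :
    ContinuousAt (fun a : ℝ =>
      sInf {x : ℝ | ∃ g : Fin (k + 1) → ℝ → ℂ,
        (∀ i, IsWeilTest (g i) ∧ tsupport (g i) ⊆ Set.Icc (-a) a) ∧ LinearIndependent ℂ g ∧
        x = sSup {y : ℝ | ∃ c : Fin (k + 1) → ℂ,
          ∫ t, ‖∑ i, c i * g i t‖ ^ 2 = (1 : ℝ) ∧
          y = (weilQuadratic (fun t => ∑ i, c i * g i t)).re}}) a₀ := by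
  rw [Metric.continuousAt_iff]
  intro ε hε
  obtain ⟨g₀, hg₀, hli₀, hlt⟩ := stub_branchesContinuous_exists_lt (k := k) ha₀ (half_pos hε)
  obtain ⟨E₀, hE₀⟩ : ∃ E₀ : ℝ, E₀ = sSup {y : ℝ | ∃ c : Fin (k + 1) → ℂ,
      ∫ t, ‖∑ i, c i * g₀ i t‖ ^ 2 = (1 : ℝ) ∧
      y = (weilQuadratic (fun t => ∑ i, c i * g₀ i t)).re} := ⟨_, rfl⟩
  obtain ⟨L₀, hL₀⟩ : ∃ L₀ : ℝ, L₀ = sInf {x : ℝ | ∃ g : Fin (k + 1) → ℝ → ℂ,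
      (∀ i, IsWeilTest (g i) ∧ tsupport (g i) ⊆ Set.Icc (-a₀) a₀) ∧ LinearIndependent ℂ g ∧
      x = sSup {y : ℝ | ∃ c : Fin (k + 1) → ℂ,
        ∫ t, ‖∑ i, c i * g i t‖ ^ 2 = (1 : ℝ) ∧
        y = (weilQuadratic (fun t => ∑ i, c i * g i t)).re}} := ⟨_, rfl⟩
  rw [← hE₀, ← hL₀] at hlt
  obtain ⟨δ₁, hδ₁, -, h₁⟩ := exists_weilDilate_modulus ha₀ E₀ (half_pos hε)
  obtain ⟨δ₂, hδ₂, -, h₂⟩ :=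
    exists_weilDilate_modulus (a := 2 * a₀) (by positivity) (L₀ + 1) (half_pos hε)
  refine ⟨min (a₀ / 2) (min (δ₁ * a₀ / 2) (δ₂ * a₀ / 2)), by positivity, fun a ha => ?_⟩
  rw [Real.dist_eq] at ha
  rw [Real.dist_eq, ← hL₀]
  have ha1 : |a - a₀| < a₀ / 2 := lt_of_lt_of_le ha (min_le_left _ _)
  have ha2 : |a - a₀| < δ₁ * a₀ / 2 :=
    lt_of_lt_of_le ha ((min_le_right _ _).trans (min_le_left _ _))
  have ha3 : |a - a₀| < δ₂ * a₀ / 2 :=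
    lt_of_lt_of_le ha ((min_le_right _ _).trans (min_le_right _ _))
  rw [abs_lt] at ha1 ha2 ha3
  have hapos : a₀ / 2 < a := by linarith [ha1.1]
  have ha0 : 0 < a := by linarith
  have hale : a ≤ 2 * a₀ := by linarith [ha1.2]
  rw [abs_sub_lt_iff]
  constructor
  · -- upper bound: `level a k < level a₀ k + ε`
    set η : ℝ := a₀ / a - 1 with hη
    have hη1 : -1 < η := by
      have : 0 < a₀ / a := div_pos ha₀ ha0
      rw [hη]; linarith
    have hηabs : |η| ≤ δ₁ := by
      rw [hη, show a₀ / a - 1 = (a₀ - a) / a by field_simp, abs_div, abs_of_pos ha0,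
        div_le_iff₀ ha0, abs_sub_comm]
      nlinarith [ha2.1, ha2.2, abs_lt.2 ⟨ha2.1, ha2.2⟩]
    have hwin : a₀ / (1 + η) = a := by
      rw [show 1 + η = a₀ / a by rw [hη]; ring, div_div_eq_mul_div, mul_div_cancel_left₀ _ ha₀.ne']
    have hg' : ∀ i, IsWeilTest (weilDilate η (g₀ i)) ∧
        tsupport (weilDilate η (g₀ i)) ⊆ Set.Icc (-a) a := by
      intro i
      refine ⟨(hg₀ i).1.weilDilate hη1, ?_⟩
      have := tsupport_weilDilate_subset (g₀ i) hη1 (hg₀ i).2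
      rwa [hwin] at this
    have hle := stub_branchesContinuous_level_le hg'
      (stub_branchesContinuous_linearIndependent_weilDilate hη1 hli₀)
    have hdil := stub_branchesContinuous_sSup_dilate_le hg₀ hli₀ hη1
      (fun f hf hfs hfn hfE => h₁ η hηabs f hf hfs hfn hfE) (le_of_eq hE₀.symm)
    rw [← hE₀] at hdil
    linarith [hlt, hle, hdil]
  · -- lower bound: `level a₀ k − ε < level a k`
    have hlb : L₀ - ε / 2 ≤ sInf {x : ℝ | ∃ g : Fin (k + 1) → ℝ → ℂ,
        (∀ i, IsWeilTest (g i) ∧ tsupport (g i) ⊆ Set.Icc (-a) a) ∧ LinearIndependent ℂ g ∧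
        x = sSup {y : ℝ | ∃ c : Fin (k + 1) → ℂ,
          ∫ t, ‖∑ i, c i * g i t‖ ^ 2 = (1 : ℝ) ∧
          y = (weilQuadratic (fun t => ∑ i, c i * g i t)).re}} := by
      refine stub_branchesContinuous_le_level ha0 fun h hh hhli => ?_
      by_cases hE : sSup {y : ℝ | ∃ c : Fin (k + 1) → ℂ,
          ∫ t, ‖∑ i, c i * h i t‖ ^ 2 = (1 : ℝ) ∧
          y = (weilQuadratic (fun t => ∑ i, c i * h i t)).re} ≤ L₀ + 1
      · set η : ℝ := a / a₀ - 1 with hη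
        have hη1 : -1 < η := by
          have : 0 < a / a₀ := div_pos ha0 ha₀
          rw [hη]; linarith
        have hηabs : |η| ≤ δ₂ := by
          rw [hη, show a / a₀ - 1 = (a - a₀) / a₀ by field_simp, abs_div, abs_of_pos ha₀,
            div_le_iff₀ ha₀]
          nlinarith [ha3.1, ha3.2, abs_lt.2 ⟨ha3.1, ha3.2⟩]
        have hwin : a / (1 + η) = a₀ := by
          rw [show 1 + η = a / a₀ by rw [hη]; ring, div_div_eq_mul_div,
            mul_div_cancel_left₀ _ ha0.ne']
        have hh2 : ∀ i, IsWeilTest (h i) ∧ tsupport (h i) ⊆ Set.Icc (-(2 * a₀)) (2 * a₀) :=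
          fun i => ⟨(hh i).1, (hh i).2.trans (Icc_subset_Icc (by linarith) hale)⟩
        have hh' : ∀ i, IsWeilTest (weilDilate η (h i)) ∧
            tsupport (weilDilate η (h i)) ⊆ Set.Icc (-a₀) a₀ := by
          intro i
          refine ⟨(hh i).1.weilDilate hη1, ?_⟩
          have := tsupport_weilDilate_subset (h i) hη1 (hh i).2
          rwa [hwin] at this
        have hle := stub_branchesContinuous_level_le hh'
          (stub_branchesContinuous_linearIndependent_weilDilate hη1 hhli)
        rw [← hL₀] at hle
        have hdil := stub_branchesContinuous_sSup_dilate_le hh2 hhli hη1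
          (fun f hf hfs hfn hfE => h₂ η hηabs f hf hfs hfn hfE) hE
        linarith [hle, hdil]
      · have hE' := not_le.1 hE
        linarith
    linarith

/-- **Stub `stub_branchesContinuous` — continuity of every eigenvalue branch.**  For every `k`, the
`k`-th Courant–Fischer level of the window form (inf over linearly independent `(k+1)`-tuples of
window test functions of the max of `Re Q` on their unit `L²`-sphere) is continuous in the window
`a ∈ (0, ∞)`.  `k = 0` is Suzuki 2026 Thm 1.3 (`Suzuki2026_thm_1_3_holds`); general `k` by the same
dilation argument `g ↦ (1+η)^{1/2} g((1+η)·)` applied to finite-dimensional trial spaces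
(`stub_branchesContinuous_continuousAt`). [folklore] -/
theorem stub_branchesContinuous :
    ∀ k : ℕ, ContinuousOn (fun a : ℝ =>
      sInf {x : ℝ | ∃ g : Fin (k + 1) → ℝ → ℂ,
        (∀ i, IsWeilTest (g i) ∧ tsupport (g i) ⊆ Set.Icc (-a) a) ∧ LinearIndependent ℂ g ∧
        x = sSup {y : ℝ | ∃ c : Fin (k + 1) → ℂ,
          ∫ t, ‖∑ i, c i * g i t‖ ^ 2 = (1 : ℝ) ∧
          y = (weilQuadratic (fun t => ∑ i, c i * g i t)).re}}) (Set.Ioi 0) :=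
  fun k _ ha => (stub_branchesContinuous_continuousAt k ha).continuousWithinAt

end Summit.RiemannHypothesis.RiemannHypothesis.Theorems.RuelleBandCofiniteCriticalLine

end
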